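import Summits.ResolutionOfSingularities.ResolutionOfSingularities.Theorems.FrobeniusLadderFInjectiveMacaulayficationX2YGBlowupRegular
import Summits.ResolutionOfSingularities.ResolutionOfSingularities.Theorems.FrobeniusLadderFInjectiveMacaulayficationE4FloorTwoWChart
import HarnessLib

/-!
# (RR-I2) floor 2, the `y`-chart: the blowing up of `x′² + y(1 + u′³ + t′³ + s′³) = 0` along its singular surface `Σ_y = V(x′, y, 1 + u′³ + t′³ + s′³)` IS REGULAR,
# `Sing = V(Σ_y)`, the centre is prime — for EVERY field with `3 ≠ 0`
# (T″-side second kernel instance on the bed `x² + y³ + u³ + t³ + s³`; crux `FInjectiveMacaulayfication` stmt-ResolutionOfSingularities-15315, chain w45a; the specialisation of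
# `X2YGCentre` / `X2YGBlowupRegular` to `Λ = k[u′, t′, s′]`, `g = 1 + u′³ + t′³ + s′³`, and the bridge to the `Fin 5` coordinates of res-L1-w45a-lead-1 g10's chart
# `g₀ = X4² + X0·(1 + X1³ + X2³ + X3³)` of ✓ `X2Cubic4PointFloor`; template = res-L1-w45a-stub-1's `E4FloorTwoWChart`; seat res-L1-w45a-lead-1 g11)

[OURS · L1 W4.5a] Support file (`--supports stmt-ResolutionOfSingularities-15315 --as helper`); replaces the role of NO printed item; NOT a statement of any
manuscript; def-free; UNCONDITIONAL. AI-written (AI review is weaker than expert review).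

* §1 `Λ = k[u′, t′, s′]`, `g = 1 + u′³ + t′³ + s′³` over a field with `3 ≠ 0`: `prime_g` (as `T³ + C(1 + u′³ + t′³)` over `k[u′, t′]`, Eisenstein at the point `(−1, 0)` where
  `1 + u′³ + t′³ = 0` and `∂_{u′} = 3u′² = 3 ≠ 0` — `HypersurfaceFormsIrreducible.irreducible_X_pow_add_C`), `g_ne_zero`, `isDomain_quotient_g`; the EULER DERIVATION
  `D₀ = u′∂_{u′} + t′∂_{t′} + s′∂_{s′}`: `euler_g` (`D₀ g = 3(g − 1)`), ★ `isUnit_mk_euler_g` (`D₀ g ≡ −3`, a unit modulo `g`) — the affine Fermat cubic SURFACE is smooth.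
* §2 the coordinate bridge over an ABSTRACT copy `ι : k[u′,t′,s′] ≃+* Λ`: `exists_ringEquiv_fin5` (`k[X₀..X₄] ≃+* Λ[T₀, T₁]`, `X₄ ↦ T₀`, `X₀ ↦ T₁`, `X₁, X₂, X₃ ↦ C(ι u′), C(ι t′),
  C(ι s′)`; Mathlib `renameEquiv ((finRotate 5).trans finSumFinEquiv.symm)`, `sumAlgEquiv`, `mapEquiv`), `exists_quotientEquiv_yChart` (`C₀ ≃+* Λ[T]/(h)` matching the centres).
* §3 the `Fin 5` frame (chart `i = 0` of `X2Cubic4PointFloor.theta`: `C₀ = k[X₀..X₄]/(g₀)`, `g₀ = X₄² + X₀ + X₀X₁³ + X₀X₂³ + X₀X₃³`, centre `c₀ = (X₄, X₀, 1 + X₁³ + X₂³ + X₃³)`,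
  `J₀ = (c₀)·C₀`): ★★ `isRegularRing_blowupAlgebra_yChart` (the chart rings `C₀[J₀/ȳ]`, `C₀[J₀/w̄]` are regular), ★★ `isRegular_affineBlowup_yChart`
  (`Scheme.IsRegular (affineBlowup J₀)`, via `X2YGBlowupRegular.isRegular_affineBlowup_of_sq_eq_neg_mul` — the `x′`-chart is covered by the other two),
  ★ `not_isRegularLocalRing_iff_yChart` (`Sing(Spec C₀) = V(J₀)` — completing g10's one-sided `X2Cubic4PointFloor.yChart_not_regular_of_le`), `isPrime_yChart` —
  all with the single hypothesis `3 ≠ 0` in `k` (every characteristic `≠ 3`); the charts `D₊(u)`, `D₊(t)`, `D₊(s)` follow by variable swaps (next file).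
[folklore; cite: Liu2002, Thm. 8.1.19 (a); StacksProject, Tag 07PF, Tag 0BIQ; GortzWedhorn2020, Prop. 13.96 (2), Prop. 13.91 (4); Hartshorne1977, II Ex. 8.20.2 (pattern)]
-/

-- single-problem summit: the doubled namespace component is forced
set_option linter.dupNamespace false

noncomputable section

namespace Summit.ResolutionOfSingularities.ResolutionOfSingularities.Theorems.FInjectiveMacaulayfication.X2Cubic4FloorTwoYChart

open MvPolynomial Literature.AlgebraicGeometry.Resolution AlgebraicGeometry
open Summit.ResolutionOfSingularities.ResolutionOfSingularities.Theorems.FInjectiveMacaulayfication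

/-! ## §1 `g = 1 + u′³ + t′³ + s′³ ∈ k[u′, t′, s′]`: prime, and the Euler derivation makes `Λ/(g)` regular -/

/-- **`g = 1 + u′³ + t′³ + s′³` is prime** when `3 ≠ 0` in `k`: `k[X₀,X₁,X₂] ≅ k[X₀,X₁][T]` (`X 0 ↦ T`, `X 1 ↦ C(X 0)`, `X 2 ↦ C(X 1)`), `g ↦ T³ + C(1 + X₀³ + X₁³)`, Eisenstein at
the point `(X₀, X₁) = (−1, 0)` (`1 + X₀³ + X₁³ = 0`, `∂/∂X₀ = 3X₀² = 3 ≠ 0`). [folklore; cite: Hartshorne1977, II Ex. 8.20.2 (pattern)] -/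
theorem prime_g (k : Type) [Field k] (h3 : (3 : k) ≠ 0) (g : MvPolynomial (Fin 3) k) (hg : g = 1 + X 0 ^ 3 + X 1 ^ 3 + X 2 ^ 3) : Prime g := by
  set e : MvPolynomial (Fin 3) k ≃+* Polynomial (MvPolynomial (Fin 2) k) := (finSuccEquiv k 2).toRingEquiv with he_def
  have he0 : e (X 0) = Polynomial.X := finSuccEquiv_X_zero
  have he1 : e (X 1) = Polynomial.C (X 0) := by
    rw [show (1 : Fin 3) = (0 : Fin 2).succ from rfl]
    exact finSuccEquiv_X_succ
  have he2 : e (X 2) = Polynomial.C (X 1) := by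
    rw [show (2 : Fin 3) = (1 : Fin 2).succ from rfl]
    exact finSuccEquiv_X_succ
  have hef : e g = Polynomial.X ^ 3 + Polynomial.C (1 + X 0 ^ 3 + X 1 ^ 3 : MvPolynomial (Fin 2) k) := by
    rw [hg, map_add, map_add, map_add, map_pow, map_pow, map_pow, map_one, he0, he1, he2, map_add, map_add, map_pow, map_pow, map_one]
    ring
  have hc : MvPolynomial.eval (![(-1 : k), 0]) (1 + X 0 ^ 3 + X 1 ^ 3 : MvPolynomial (Fin 2) k) = 0 := by
    simp only [map_add, map_pow, eval_X, map_one, Matrix.cons_val_zero, Matrix.cons_val_one]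
    norm_num
  have hder : MvPolynomial.eval (![(-1 : k), 0]) (pderiv 0 (1 + X 0 ^ 3 + X 1 ^ 3 : MvPolynomial (Fin 2) k)) ≠ 0 := by
    have e1 : pderiv 0 (1 + X 0 ^ 3 + X 1 ^ 3 : MvPolynomial (Fin 2) k) = 3 * X 0 ^ 2 := by
      rw [map_add, map_add, Derivation.map_one_eq_zero, zero_add, pderiv_pow, pderiv_pow, pderiv_X_self,
        pderiv_X_of_ne (show (1 : Fin 2) ≠ 0 by decide)]
      push_cast
      ring
    rw [e1, map_mul, map_pow, eval_X, map_ofNat, Matrix.cons_val_zero]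
    norm_num
    exact h3
  have hirr : Irreducible (e g) := by
    rw [hef]
    exact Literature.AlgebraicGeometry.Motives.SmoothHypersurface.irreducible_X_pow_add_C (d := 3) (by norm_num) _ _ hc 0 hder
  exact (MulEquiv.prime_iff e).mp hirr.prime

/-- `g ≠ 0`. [plumbing] -/
theorem g_ne_zero (k : Type) [Field k] (h3 : (3 : k) ≠ 0) (g : MvPolynomial (Fin 3) k) (hg : g = 1 + X 0 ^ 3 + X 1 ^ 3 + X 2 ^ 3) : g ≠ 0 :=
  (prime_g k h3 g hg).ne_zero

/-- `k[u′,t′,s′]/(g)` is a domain. [folklore] -/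
theorem isDomain_quotient_g (k : Type) [Field k] (h3 : (3 : k) ≠ 0) (g : MvPolynomial (Fin 3) k) (hg : g = 1 + X 0 ^ 3 + X 1 ^ 3 + X 2 ^ 3) :
    IsDomain (MvPolynomial (Fin 3) k ⧸ Ideal.span {g}) :=
  haveI := (Ideal.span_singleton_prime (g_ne_zero k h3 g hg)).mpr (prime_g k h3 g hg)
  Ideal.Quotient.isDomain _

/-- **The Euler derivation on `g`**: `(u′∂_{u′} + t′∂_{t′} + s′∂_{s′}) g = 3u′³ + 3t′³ + 3s′³`. [folklore] -/
theorem euler_g (k : Type) [Field k] (g : MvPolynomial (Fin 3) k) (hg : g = 1 + X 0 ^ 3 + X 1 ^ 3 + X 2 ^ 3) :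
    ((X 0 : MvPolynomial (Fin 3) k) • (pderiv 0 : Derivation k (MvPolynomial (Fin 3) k) (MvPolynomial (Fin 3) k)) +
        (X 1 : MvPolynomial (Fin 3) k) • (pderiv 1 : Derivation k (MvPolynomial (Fin 3) k) (MvPolynomial (Fin 3) k)) +
        (X 2 : MvPolynomial (Fin 3) k) • (pderiv 2 : Derivation k (MvPolynomial (Fin 3) k) (MvPolynomial (Fin 3) k))) g =
      3 * X 0 ^ 3 + 3 * X 1 ^ 3 + 3 * X 2 ^ 3 := by
  rw [hg, Derivation.add_apply, Derivation.add_apply, Derivation.smul_apply, Derivation.smul_apply, Derivation.smul_apply]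
  simp only [map_add, Derivation.map_one_eq_zero, pderiv_pow, pderiv_X_self, pderiv_X_of_ne (show (1 : Fin 3) ≠ 0 by decide),
    pderiv_X_of_ne (show (2 : Fin 3) ≠ 0 by decide), pderiv_X_of_ne (show (0 : Fin 3) ≠ 1 by decide), pderiv_X_of_ne (show (2 : Fin 3) ≠ 1 by decide),
    pderiv_X_of_ne (show (0 : Fin 3) ≠ 2 by decide), pderiv_X_of_ne (show (1 : Fin 3) ≠ 2 by decide), smul_eq_mul, mul_zero, mul_one, zero_add, add_zero]
  push_cast
  ring

/-- ★ **`D₀ g` is a unit modulo `g`** for the Euler derivation when `3 ≠ 0` in `k`: `D₀ g = 3(g − 1) ≡ −3`. So `k[u′,t′,s′]/(g)` is a regular ring by Stacks 07PF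
(`isRegularRing_quotient_of_derivation`) — the smooth affine Fermat cubic surface. [folklore; cite: StacksProject, Tag 07PF] -/
theorem isUnit_mk_euler_g (k : Type) [Field k] (h3 : (3 : k) ≠ 0) (g : MvPolynomial (Fin 3) k) (hg : g = 1 + X 0 ^ 3 + X 1 ^ 3 + X 2 ^ 3) :
    IsUnit (Ideal.Quotient.mk (Ideal.span {g})
      (((X 0 : MvPolynomial (Fin 3) k) • (pderiv 0 : Derivation k (MvPolynomial (Fin 3) k) (MvPolynomial (Fin 3) k)) +
        (X 1 : MvPolynomial (Fin 3) k) • (pderiv 1 : Derivation k (MvPolynomial (Fin 3) k) (MvPolynomial (Fin 3) k)) +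
        (X 2 : MvPolynomial (Fin 3) k) • (pderiv 2 : Derivation k (MvPolynomial (Fin 3) k) (MvPolynomial (Fin 3) k))) g)) := by
  rw [euler_g k g hg]
  have hrw : (3 * X 0 ^ 3 + 3 * X 1 ^ 3 + 3 * X 2 ^ 3 : MvPolynomial (Fin 3) k) = 3 * g - 3 := by rw [hg]; ring
  have hg0 : Ideal.Quotient.mk (Ideal.span {g}) g = 0 := Ideal.Quotient.eq_zero_iff_mem.mpr (Ideal.mem_span_singleton_self g)
  rw [hrw, map_sub, map_mul, hg0, mul_zero, zero_sub, map_ofNat]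
  have h3u : IsUnit ((3 : MvPolynomial (Fin 3) k ⧸ Ideal.span {g})) := by
    have := (Ne.isUnit h3).map (algebraMap k (MvPolynomial (Fin 3) k ⧸ Ideal.span {g}))
    rwa [map_ofNat] at this
  exact h3u.neg

/-! ## §2 The coordinate bridge `k[X₀, …, X₄] ≃ Λ[T₀, T₁]` -/

/-- **`k[X₀, …, X₄] ≃+* Λ[T₀, T₁]` over a ring isomorphism `ι : k[u′, t′, s′] ≃+* Λ`**: `X₄ ↦ T₀` (`x′`), `X₀ ↦ T₁` (`y`), `X₁, X₂, X₃ ↦ C(ι u′), C(ι t′), C(ι s′)`,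
`c ↦ C(ι c)` (Mathlib `renameEquiv ((finRotate 5).trans finSumFinEquiv.symm)`, `sumAlgEquiv`, `mapEquiv`). Keeping `Λ` ABSTRACT is deliberate: the chart algebra is then
instantiated by pure application, never by unification across the two polynomial layers. [folklore] -/
theorem exists_ringEquiv_fin5 (k : Type) [Field k] {Λ : Type} [CommRing Λ] (ι : MvPolynomial (Fin 3) k ≃+* Λ) :
    ∃ ε : MvPolynomial (Fin 5) k ≃+* MvPolynomial (Fin 2) Λ,
      ε (X 4) = X 0 ∧ ε (X 0) = X 1 ∧ ε (X 1) = C (ι (X 0)) ∧ ε (X 2) = C (ι (X 1)) ∧ ε (X 3) = C (ι (X 2)) ∧ ∀ c : k, ε (C c) = C (ι (C c)) := by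
  let ε₀ : MvPolynomial (Fin 5) k ≃+* MvPolynomial (Fin 2) (MvPolynomial (Fin 3) k) :=
    ((renameEquiv k ((_root_.finRotate 5).trans (finSumFinEquiv (m := 2) (n := 3)).symm)).trans (sumAlgEquiv k (Fin 2) (Fin 3))).toRingEquiv
  have hX : ∀ j : Fin 5, ε₀ (X j) = sumAlgEquiv k (Fin 2) (Fin 3) (X (((_root_.finRotate 5).trans (finSumFinEquiv (m := 2) (n := 3)).symm) j)) := by
    intro j
    change sumAlgEquiv k (Fin 2) (Fin 3) (renameEquiv k _ (X j)) = _
    rw [renameEquiv_apply, rename_X]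
  have h4 : ε₀ (X 4) = X 0 := by
    rw [hX, show ((_root_.finRotate 5).trans (finSumFinEquiv (m := 2) (n := 3)).symm) (4 : Fin 5) = Sum.inl 0 by decide, sumAlgEquiv_X_inl]
  have h0 : ε₀ (X 0) = X 1 := by
    rw [hX, show ((_root_.finRotate 5).trans (finSumFinEquiv (m := 2) (n := 3)).symm) (0 : Fin 5) = Sum.inl 1 by decide, sumAlgEquiv_X_inl]
  have h1 : ε₀ (X 1) = C (X 0) := by
    rw [hX, show ((_root_.finRotate 5).trans (finSumFinEquiv (m := 2) (n := 3)).symm) (1 : Fin 5) = Sum.inr 0 by decide, sumAlgEquiv_X_inr]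
  have h2 : ε₀ (X 2) = C (X 1) := by
    rw [hX, show ((_root_.finRotate 5).trans (finSumFinEquiv (m := 2) (n := 3)).symm) (2 : Fin 5) = Sum.inr 1 by decide, sumAlgEquiv_X_inr]
  have h3' : ε₀ (X 3) = C (X 2) := by
    rw [hX, show ((_root_.finRotate 5).trans (finSumFinEquiv (m := 2) (n := 3)).symm) (3 : Fin 5) = Sum.inr 2 by decide, sumAlgEquiv_X_inr]
  have hC : ∀ c : k, ε₀ (C c) = C (C c) := fun c => by
    change sumAlgEquiv k (Fin 2) (Fin 3) (renameEquiv k _ (C c)) = _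
    rw [renameEquiv_apply, rename_C, sumAlgEquiv_C_inl]
  -- change coefficients along `ι`
  let ε := ε₀.trans (mapEquiv (Fin 2) ι)
  have hε : ∀ x, ε x = MvPolynomial.map (ι : MvPolynomial (Fin 3) k →+* Λ) (ε₀ x) := fun x => rfl
  refine ⟨ε, ?_, ?_, ?_, ?_, ?_, fun c => ?_⟩
  · rw [hε, h4, map_X]
  · rw [hε, h0, map_X]
  · rw [hε, h1, map_C]; rfl
  · rw [hε, h2, map_C]; rfl
  · rw [hε, h3', map_C]; rfl
  · rw [hε, hC, map_C]; rfl

/-- **The quotient bridge `C₀ ≃+* Λ[T]/(h)`** carrying the centre `(X₄, X₀, 1 + X₁³ + X₂³ + X₃³)·C₀` onto `(T₀, T₁, C g)·(R/(h))` generator by generator, for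
`g = ι(1 + u′³ + t′³ + s′³)`. [plumbing] -/
theorem exists_quotientEquiv_yChart (k : Type) [Field k] {Λ : Type} [CommRing Λ] (ι : MvPolynomial (Fin 3) k ≃+* Λ)
    (g₀ : MvPolynomial (Fin 5) k) (hg₀ : g₀ = X 4 ^ 2 + X 0 + X 0 * X 1 ^ 3 + X 0 * X 2 ^ 3 + X 0 * X 3 ^ 3)
    (c₀ : Fin 3 → MvPolynomial (Fin 5) k) (hc₀ : c₀ = ![X 4, X 0, 1 + X 1 ^ 3 + X 2 ^ 3 + X 3 ^ 3])
    (J₀ : Ideal (MvPolynomial (Fin 5) k ⧸ Ideal.span {g₀})) (hJ₀ : J₀ = (Ideal.span (Set.range c₀)).map (Ideal.Quotient.mk (Ideal.span {g₀})))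
    (g : Λ) (hg : g = ι (1 + X 0 ^ 3 + X 1 ^ 3 + X 2 ^ 3))
    (cen : Fin 3 → MvPolynomial (Fin 2) Λ) (hcen : cen = ![X 0, X 1, C g])
    (h : MvPolynomial (Fin 2) Λ) (hh : h = X 0 ^ 2 + X 1 * C g) :
    ∃ εq : (MvPolynomial (Fin 5) k ⧸ Ideal.span {g₀}) ≃+* (MvPolynomial (Fin 2) Λ ⧸ Ideal.span {h}),
      (∀ p, εq (Ideal.Quotient.mk (Ideal.span {g₀}) (c₀ p)) = Ideal.Quotient.mk (Ideal.span {h}) (cen p)) ∧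
        Ideal.map εq J₀ = (Ideal.span (Set.range cen)).map (Ideal.Quotient.mk (Ideal.span {h})) := by
  obtain ⟨ε, e4, e0, e1, e2, e3, -⟩ := exists_ringEquiv_fin5 k ι
  have eg : ε (1 + X 1 ^ 3 + X 2 ^ 3 + X 3 ^ 3) = C g := by
    rw [hg]
    simp only [map_add, map_one, map_pow, e1, e2, e3]
  have hεg : ε g₀ = h := by
    have e' : g₀ = X 4 ^ 2 + X 0 * (1 + X 1 ^ 3 + X 2 ^ 3 + X 3 ^ 3) := by rw [hg₀]; ring
    rw [e', hh, map_add, map_pow, map_mul, e4, e0, eg]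
  have hεc : ∀ p, ε (c₀ p) = cen p := by
    intro p
    subst hc₀ hcen
    fin_cases p
    · exact e4
    · exact e0
    · exact eg
  have hmap : Ideal.span {h} = (Ideal.span {g₀}).map (ε : MvPolynomial (Fin 5) k →+* MvPolynomial (Fin 2) Λ) := by
    rw [Ideal.map_span, Set.image_singleton]
    exact congrArg _ (congrArg _ hεg.symm)
  let εq := Ideal.quotientEquiv (Ideal.span {g₀}) (Ideal.span {h}) ε hmap
  have hεq : ∀ x, εq (Ideal.Quotient.mk (Ideal.span {g₀}) x) = Ideal.Quotient.mk (Ideal.span {h}) (ε x) := fun x =>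
    Ideal.quotientEquiv_mk _ _ _ _ x
  refine ⟨εq, fun p => by rw [hεq, hεc], ?_⟩
  have hcomp : (εq : _ →+* _).comp (Ideal.Quotient.mk (Ideal.span {g₀})) =
      (Ideal.Quotient.mk (Ideal.span {h})).comp (ε : MvPolynomial (Fin 5) k →+* MvPolynomial (Fin 2) Λ) :=
    RingHom.ext fun x => hεq x
  have hfun : ((ε : MvPolynomial (Fin 5) k →+* MvPolynomial (Fin 2) Λ) ∘ c₀ : Fin 3 → _) = cen :=
    funext fun p => by rw [Function.comp_apply, RingEquiv.coe_toRingHom]; exact hεc p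
  have key : Ideal.map (εq : _ →+* _) J₀ = (Ideal.span (Set.range cen)).map (Ideal.Quotient.mk (Ideal.span {h})) := by
    rw [hJ₀, Ideal.map_map, hcomp, ← Ideal.map_map, Ideal.map_span, ← Set.range_comp, hfun]
  exact key

/-! ## §3 The chart `C₀ = k[X₀..X₄]/(X₄² + X₀(1 + X₁³ + X₂³ + X₃³))` of `Bl_𝔪 Y` and its centre `(X₄, X₀, 1 + X₁³ + X₂³ + X₃³)` -/

/-- The two chart rings `C₀[J₀/ȳ]`, `C₀[J₀/w̄]` over an ABSTRACT copy `Λ` of `k[u′,t′,s′]` (instantiate with `ι = RingEquiv.refl`). [plumbing] -/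
theorem isRegularRing_blowupAlgebra_yChart_aux (k : Type) [Field k] {Λ : Type} [CommRing Λ] [IsRegularRing Λ] (ι : MvPolynomial (Fin 3) k ≃+* Λ)
    (g : Λ) (hg : g = ι (1 + X 0 ^ 3 + X 1 ^ 3 + X 2 ^ 3)) [IsDomain (Λ ⧸ Ideal.span {g})] (hg0 : IsSMulRegular Λ g)
    {S₀ : Type} [CommRing S₀] [Algebra S₀ Λ] (D₀ : Derivation S₀ Λ Λ) (hD₀ : IsUnit (Ideal.Quotient.mk (Ideal.span {g}) (D₀ g)))
    (g₀ : MvPolynomial (Fin 5) k) (hg₀ : g₀ = X 4 ^ 2 + X 0 + X 0 * X 1 ^ 3 + X 0 * X 2 ^ 3 + X 0 * X 3 ^ 3)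
    (c₀ : Fin 3 → MvPolynomial (Fin 5) k) (hc₀ : c₀ = ![X 4, X 0, 1 + X 1 ^ 3 + X 2 ^ 3 + X 3 ^ 3])
    (J₀ : Ideal (MvPolynomial (Fin 5) k ⧸ Ideal.span {g₀})) (hJ₀ : J₀ = (Ideal.span (Set.range c₀)).map (Ideal.Quotient.mk (Ideal.span {g₀}))) :
    IsRegularRing (blowupAlgebra J₀ (Ideal.Quotient.mk (Ideal.span {g₀}) (c₀ 1))) ∧
      IsRegularRing (blowupAlgebra J₀ (Ideal.Quotient.mk (Ideal.span {g₀}) (c₀ 2))) := by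
  obtain ⟨εq, hεq, hJ'⟩ := exists_quotientEquiv_yChart k ι g₀ hg₀ c₀ hc₀ J₀ hJ₀ g hg _ rfl _ rfl
  obtain ⟨r1, r2⟩ := X2YGBlowupRegular.isRegularRing_blowupAlgebra_strictTransform g _ _ hg0 D₀ hD₀ rfl rfl _ rfl
  exact ⟨E4FloorTwoWChart.isRegularRing_blowupAlgebra_of_ringEquiv εq J₀ _ _ _ hJ'.symm (hεq 1).symm r1,
    E4FloorTwoWChart.isRegularRing_blowupAlgebra_of_ringEquiv εq J₀ _ _ _ hJ'.symm (hεq 2).symm r2⟩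

/-- `Sing = V(J₀)` over an ABSTRACT copy `Λ` of `k[u′,t′,s′]` (instantiate with `ι = RingEquiv.refl`). [plumbing] -/
theorem not_isRegularLocalRing_iff_yChart_aux (k : Type) [Field k] {Λ : Type} [CommRing Λ] [IsRegularRing Λ] [IsDomain Λ]
    (ι : MvPolynomial (Fin 3) k ≃+* Λ) (g : Λ) (hg : g = ι (1 + X 0 ^ 3 + X 1 ^ 3 + X 2 ^ 3)) (hg0 : g ≠ 0)
    {S₀ : Type} [CommRing S₀] [Algebra S₀ Λ] (D₀ : Derivation S₀ Λ Λ) (hD₀ : IsUnit (Ideal.Quotient.mk (Ideal.span {g}) (D₀ g)))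
    (g₀ : MvPolynomial (Fin 5) k) (hg₀ : g₀ = X 4 ^ 2 + X 0 + X 0 * X 1 ^ 3 + X 0 * X 2 ^ 3 + X 0 * X 3 ^ 3)
    (c₀ : Fin 3 → MvPolynomial (Fin 5) k) (hc₀ : c₀ = ![X 4, X 0, 1 + X 1 ^ 3 + X 2 ^ 3 + X 3 ^ 3])
    (J₀ : Ideal (MvPolynomial (Fin 5) k ⧸ Ideal.span {g₀})) (hJ₀ : J₀ = (Ideal.span (Set.range c₀)).map (Ideal.Quotient.mk (Ideal.span {g₀})))
    (P : Ideal (MvPolynomial (Fin 5) k ⧸ Ideal.span {g₀})) [P.IsPrime] :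
    ¬ IsRegularLocalRing (Localization.AtPrime P) ↔ J₀ ≤ P := by
  obtain ⟨εq, -, hJ⟩ := exists_quotientEquiv_yChart k ι g₀ hg₀ c₀ hc₀ J₀ hJ₀ g hg _ rfl _ rfl
  haveI hQ : (P.map εq).IsPrime := Ideal.map_isPrime_of_equiv εq
  have hPc : P = (P.map εq).comap εq := (Ideal.comap_map_of_bijective εq εq.bijective).symm
  have key := X2YGBlowupRegular.not_isRegularLocalRing_iff_map_le g _ _ hg0 D₀ hD₀ rfl rfl (P.map εq)
  rw [E4FloorTwoWChart.isRegularLocalRing_localization_iff_of_ringEquiv εq P (P.map εq) hPc, key, ← hJ, Ideal.map_le_iff_le_comap, ← hPc]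

/-- `J₀` is prime, over an ABSTRACT copy `Λ` of `k[u′,t′,s′]` (instantiate with `ι = RingEquiv.refl`). [plumbing] -/
theorem isPrime_yChart_aux (k : Type) [Field k] {Λ : Type} [CommRing Λ] (ι : MvPolynomial (Fin 3) k ≃+* Λ)
    (g : Λ) (hg : g = ι (1 + X 0 ^ 3 + X 1 ^ 3 + X 2 ^ 3)) [IsDomain (Λ ⧸ Ideal.span {g})]
    (g₀ : MvPolynomial (Fin 5) k) (hg₀ : g₀ = X 4 ^ 2 + X 0 + X 0 * X 1 ^ 3 + X 0 * X 2 ^ 3 + X 0 * X 3 ^ 3)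
    (c₀ : Fin 3 → MvPolynomial (Fin 5) k) (hc₀ : c₀ = ![X 4, X 0, 1 + X 1 ^ 3 + X 2 ^ 3 + X 3 ^ 3])
    (J₀ : Ideal (MvPolynomial (Fin 5) k ⧸ Ideal.span {g₀})) (hJ₀ : J₀ = (Ideal.span (Set.range c₀)).map (Ideal.Quotient.mk (Ideal.span {g₀}))) :
    J₀.IsPrime := by
  obtain ⟨εq, -, hJ⟩ := exists_quotientEquiv_yChart k ι g₀ hg₀ c₀ hc₀ J₀ hJ₀ g hg _ rfl _ rfl
  have hJ'c : J₀ = ((Ideal.span (Set.range (![X 0, X 1, C g] : Fin 3 → MvPolynomial (Fin 2) Λ))).map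
      (Ideal.Quotient.mk (Ideal.span {(X 0 ^ 2 + X 1 * C g : MvPolynomial (Fin 2) Λ)}))).comap εq := by
    rw [← hJ]; exact (Ideal.comap_map_of_bijective εq εq.bijective).symm
  haveI := X2YGBlowupRegular.isPrime_map_span_cen g _ _ rfl rfl
  rw [hJ'c]; exact Ideal.comap_isPrime εq _

/-- ★★ **THE CHART RINGS `C₀[J₀/ȳ]` AND `C₀[J₀/w̄]` OF THE BLOWING UP OF `C₀ = k[X₀..X₄]/(X₄² + X₀(1 + X₁³ + X₂³ + X₃³))` ALONG `J₀ = (X₄, X₀, 1 + X₁³ + X₂³ + X₃³)·C₀`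
ARE REGULAR** (`3 ≠ 0` in `k`; the `y`-chart of `Bl_𝔪 Y`, `Y = {x² + y³ + u³ + t³ + s³}`, in the coordinates of `X2Cubic4PointFloor.theta`, chart `i = 0`).
[folklore; cite: Liu2002, Thm. 8.1.19 (a); GortzWedhorn2020, Prop. 13.96 (2)] -/
theorem isRegularRing_blowupAlgebra_yChart (k : Type) [Field k] (h3 : (3 : k) ≠ 0)
    (g₀ : MvPolynomial (Fin 5) k) (hg₀ : g₀ = X 4 ^ 2 + X 0 + X 0 * X 1 ^ 3 + X 0 * X 2 ^ 3 + X 0 * X 3 ^ 3)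
    (c₀ : Fin 3 → MvPolynomial (Fin 5) k) (hc₀ : c₀ = ![X 4, X 0, 1 + X 1 ^ 3 + X 2 ^ 3 + X 3 ^ 3])
    (J₀ : Ideal (MvPolynomial (Fin 5) k ⧸ Ideal.span {g₀})) (hJ₀ : J₀ = (Ideal.span (Set.range c₀)).map (Ideal.Quotient.mk (Ideal.span {g₀}))) :
    IsRegularRing (blowupAlgebra J₀ (Ideal.Quotient.mk (Ideal.span {g₀}) (c₀ 1))) ∧
      IsRegularRing (blowupAlgebra J₀ (Ideal.Quotient.mk (Ideal.span {g₀}) (c₀ 2))) :=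
  haveI := isDomain_quotient_g k h3 (1 + X 0 ^ 3 + X 1 ^ 3 + X 2 ^ 3) rfl
  isRegularRing_blowupAlgebra_yChart_aux k (RingEquiv.refl _) (1 + X 0 ^ 3 + X 1 ^ 3 + X 2 ^ 3) rfl
    (ODPCurveCentre.isSMulRegular_of_ne_zero _ (g_ne_zero k h3 _ rfl)) _ (isUnit_mk_euler_g k h3 _ rfl) g₀ hg₀ c₀ hc₀ J₀ hJ₀

/-- **`x̄′² = −ȳ·w̄` in `C₀`** (`g₀ = X₄² + X₀·w`). [plumbing] -/
theorem mk_sq_eq_neg_mul (k : Type) [Field k]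
    (g₀ : MvPolynomial (Fin 5) k) (hg₀ : g₀ = X 4 ^ 2 + X 0 + X 0 * X 1 ^ 3 + X 0 * X 2 ^ 3 + X 0 * X 3 ^ 3)
    (c₀ : Fin 3 → MvPolynomial (Fin 5) k) (hc₀ : c₀ = ![X 4, X 0, 1 + X 1 ^ 3 + X 2 ^ 3 + X 3 ^ 3]) :
    Ideal.Quotient.mk (Ideal.span {g₀}) (c₀ 0) ^ 2 =
      -(Ideal.Quotient.mk (Ideal.span {g₀}) (c₀ 1) * Ideal.Quotient.mk (Ideal.span {g₀}) (c₀ 2)) := by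
  subst hc₀
  rw [← map_pow, ← map_mul, ← map_neg, Ideal.Quotient.eq, Ideal.mem_span_singleton]
  refine ⟨1, ?_⟩
  rw [hg₀]
  simp only [Matrix.cons_val_zero, Matrix.cons_val_one, Matrix.cons_val]
  ring

/-- ★★ **`Bl_{J₀} Spec C₀` IS A REGULAR SCHEME** (`3 ≠ 0` in `k`): the two regular chart rings and the reduction `(ȳ, w̄)` of the centre
(`X2YGBlowupRegular.isRegular_affineBlowup_of_sq_eq_neg_mul` — the `x′`-chart is covered by the other two). [folklore; cite: Liu2002, Thm. 8.1.19 (a); GortzWedhorn2020,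
Prop. 13.91 (4), (13.19)] -/
theorem isRegular_affineBlowup_yChart (k : Type) [Field k] (h3 : (3 : k) ≠ 0)
    (g₀ : MvPolynomial (Fin 5) k) (hg₀ : g₀ = X 4 ^ 2 + X 0 + X 0 * X 1 ^ 3 + X 0 * X 2 ^ 3 + X 0 * X 3 ^ 3)
    (c₀ : Fin 3 → MvPolynomial (Fin 5) k) (hc₀ : c₀ = ![X 4, X 0, 1 + X 1 ^ 3 + X 2 ^ 3 + X 3 ^ 3])
    (J₀ : Ideal (MvPolynomial (Fin 5) k ⧸ Ideal.span {g₀})) (hJ₀ : J₀ = (Ideal.span (Set.range c₀)).map (Ideal.Quotient.mk (Ideal.span {g₀}))) :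
    Scheme.IsRegular (affineBlowup J₀) := by
  obtain ⟨r1, r2⟩ := isRegularRing_blowupAlgebra_yChart k h3 g₀ hg₀ c₀ hc₀ J₀ hJ₀
  refine X2YGBlowupRegular.isRegular_affineBlowup_of_sq_eq_neg_mul J₀ (fun l => Ideal.Quotient.mk (Ideal.span {g₀}) (c₀ l)) ?_
    (mk_sq_eq_neg_mul k g₀ hg₀ c₀ hc₀) r1 r2
  rw [hJ₀, Ideal.map_span, ← Set.range_comp]
  rfl

/-- ★ **`Sing(Spec C₀) = V(J₀)`**: a prime `P` of `C₀` is a singular point (`(C₀)_P` not regular) iff `P ⊇ J₀` (`3 ≠ 0` in `k`) — both inclusions, completing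
res-L1-w45a-lead-1 g10's one-sided `X2Cubic4PointFloor.yChart_not_regular_of_le`; the ring side of the chart identification «𝓚_Σ|_{D₊(y)} = (x̄′, ȳ, w̄)~».
[cite: StacksProject, Tag 07PF] [cite: Matsumura1987, Thm. 14.2] -/
theorem not_isRegularLocalRing_iff_yChart (k : Type) [Field k] (h3 : (3 : k) ≠ 0)
    (g₀ : MvPolynomial (Fin 5) k) (hg₀ : g₀ = X 4 ^ 2 + X 0 + X 0 * X 1 ^ 3 + X 0 * X 2 ^ 3 + X 0 * X 3 ^ 3)
    (c₀ : Fin 3 → MvPolynomial (Fin 5) k) (hc₀ : c₀ = ![X 4, X 0, 1 + X 1 ^ 3 + X 2 ^ 3 + X 3 ^ 3])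
    (J₀ : Ideal (MvPolynomial (Fin 5) k ⧸ Ideal.span {g₀})) (hJ₀ : J₀ = (Ideal.span (Set.range c₀)).map (Ideal.Quotient.mk (Ideal.span {g₀})))
    (P : Ideal (MvPolynomial (Fin 5) k ⧸ Ideal.span {g₀})) [P.IsPrime] :
    ¬ IsRegularLocalRing (Localization.AtPrime P) ↔ J₀ ≤ P :=
  not_isRegularLocalRing_iff_yChart_aux k (RingEquiv.refl _) (1 + X 0 ^ 3 + X 1 ^ 3 + X 2 ^ 3) rfl (g_ne_zero k h3 _ rfl) _
    (isUnit_mk_euler_g k h3 _ rfl) g₀ hg₀ c₀ hc₀ J₀ hJ₀ P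

/-- **`J₀ = (X₄, X₀, 1 + X₁³ + X₂³ + X₃³)·C₀` is a prime ideal** (`3 ≠ 0` in `k`): `C₀/J₀ ≅ k[u′,t′,s′]/(1 + u′³ + t′³ + s′³)`, the affine Fermat cubic surface. [folklore] -/
theorem isPrime_yChart (k : Type) [Field k] (h3 : (3 : k) ≠ 0)
    (g₀ : MvPolynomial (Fin 5) k) (hg₀ : g₀ = X 4 ^ 2 + X 0 + X 0 * X 1 ^ 3 + X 0 * X 2 ^ 3 + X 0 * X 3 ^ 3)
    (c₀ : Fin 3 → MvPolynomial (Fin 5) k) (hc₀ : c₀ = ![X 4, X 0, 1 + X 1 ^ 3 + X 2 ^ 3 + X 3 ^ 3])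
    (J₀ : Ideal (MvPolynomial (Fin 5) k ⧸ Ideal.span {g₀})) (hJ₀ : J₀ = (Ideal.span (Set.range c₀)).map (Ideal.Quotient.mk (Ideal.span {g₀}))) :
    J₀.IsPrime :=
  haveI := isDomain_quotient_g k h3 (1 + X 0 ^ 3 + X 1 ^ 3 + X 2 ^ 3) rfl
  isPrime_yChart_aux k (RingEquiv.refl _) (1 + X 0 ^ 3 + X 1 ^ 3 + X 2 ^ 3) rfl g₀ hg₀ c₀ hc₀ J₀ hJ₀

end Summit.ResolutionOfSingularities.ResolutionOfSingularities.Theorems.FInjectiveMacaulayfication.X2Cubic4FloorTwoYChart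

end
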